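import Literature.NumberTheory.Automorphic.CentralOneParameterODE
import HarnessLib

/-!
# Functions annihilated by an ideal of finite codimension of `Z(𝔤)` are determined, along
# commuting central one-parameter subgroups, by their values on a finite grid

Topic `NumberTheory/Automorphic`; sequel of `CentralOneParameterODE` (the split-centre step of
Harish-Chandra's finiteness theorem, Borel–Jacquet 1979, 4.3 (i) — the tree's named fact
`harishChandra_finiteness` of `LangAutomorphicForms`). There it is proved that if `Z ∈ 𝔤` is central
and `J ≤ Z(𝔤)` has finite codimension, every archimedean-smooth `φ : G → ℂ` annihilated by `J` has
all its one-parameter slices `t ↦ φ (g · ι(exp tZ))` in ONE finite-dimensional space `E_Z` of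
smooth functions on `ℝ` (`exists_finrank_span_oneParam_le`; Borel 1997, 8.6: "belongs to a finite
dimensional space of functions"; Moeglin–Waldspurger I.3.2). This file draws the consequence used
to prove finiteness statements by EVALUATION AT FINITELY MANY POINTS:

* `exists_finset_determining` (**proved**, linear algebra): a finite-dimensional space `E` of
  functions `X → 𝕜` is determined by its values on a finite set `T ⊆ X`: `u ∈ E`, `u|_T = 0`
  imply `u = 0` (induction on `dim E`: cut `E` by the hyperplane `u(x₀) = 0` through a point `x₀`
  where some `u₀ ∈ E` does not vanish).
* `eq_zero_of_forall_grid` (**proved**, group theory): for pairwise commuting one-parameter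
  families `e₀, …, e_{d-1} : ℝ → G` and subspaces `E_i` of functions on `ℝ` determined by finite
  sets `T_i`, every `φ : G → ℂ` all of whose slices `s ↦ φ (g · e_i(s))` lie in `E_i` (a linear
  condition on `φ`) and which vanishes at the finitely many points `g · e₀(t₀) ⋯ e_{d-1}(t_{d-1})`,
  `t_i ∈ T_i`, vanishes at every `g · e₀(s₀) ⋯ e_{d-1}(s_{d-1})` (induction on `d`, commuting the
  last flow past the others).
* `exists_submodule_forall_central_grid` (**proved**, the automorphic form of the statement): for
  central `Z₀, …, Z_{d-1} ∈ 𝔤` and `J ≤ Z(𝔤)` of finite codimension there are a submodule `W` of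
  functions `G → ℂ` containing every archimedean-smooth `φ` annihilated by `J`, and finite sets
  `T_i ⊂ ℝ`, such that every `φ ∈ W` vanishing at the points `g · ι(exp (∑ tᵢ Zᵢ))`, `tᵢ ∈ Tᵢ`,
  vanishes at all `g · ι(exp (∑ sᵢ Zᵢ))`, `s ∈ ℝ^d`. Because `W` is a submodule, the statement
  applies to SPANS of automorphic forms (the shape of `harishChandra_finiteness`), and it reduces
  "the forms of type `(U, J, M)` span a finite-dimensional space" to the finiteness of a set of
  representatives modulo the subgroups along which the forms are invariant or governed by `J` —
  for `GL₁` this is all of Harish-Chandra's finiteness theorem (`HarishChandraFinitenessGLOne`),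
  for `GL_n` it is the reduction to the group `GL_n(𝔸_K)¹` (Moeglin–Waldspurger I.3.2–I.3.3).

* `exists_finset_interpolation` (**proved**): the same with coefficients — `u = ∑_{x ∈ T} u(x) b_x`
  for all `u ∈ E`, with `b_x ∈ E` (a linear left inverse of the restriction to `T`).
* `exists_finiteDimensional_forall_slices_mem` (**proved**): functions on `X × Y` with all slices
  `f(·, y)` in a finite-dimensional `W₁` and all slices `f(x, ·)` in a finite-dimensional `W₂` lie in
  one finite-dimensional space (`∑_{s ∈ T} b_s ⊗ W₂`) — the linear algebra of the Levi step of
  Harish-Chandra's finiteness theorem (forms on `M₁ × M₂` of bounded type in each variable).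
* `exists_finset_interpolation_central`, `exists_finset_translate_expMem_mem_span` (**proved**):
  along a central one-parameter subgroup, `φ (g · ι(exp sZ)) = ∑_{t ∈ T} φ (g · ι(exp tZ)) b_t(s)`
  for all archimedean-smooth `φ` killed by `J`, so the translates of `φ` along `exp (ℝ Z)` span a
  space of dimension `≤ |T|` (for `GL_n`, `Z = 1`: `A_G`-finiteness; Borel 1997, 8.6,
  Moeglin–Waldspurger I.3.2).

Everything is proved: theorems only, no definition, no named fact.

## References

* A. Borel, H. Jacquet, *Automorphic forms and automorphic representations*, Proc. Sympos. Pure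
  Math. 33 (1979), part 1, 4.3 (i) [BorelJacquet1979].
* A. Borel, *Automorphic forms on `SL₂(ℝ)`* (1997), 8.6 (proof of the finiteness theorem 8.5: the
  constant term "belongs to a finite dimensional space of functions on `A`") [Borel1997].
* C. Moeglin, J.-L. Waldspurger, *Spectral decomposition and Eisenstein series* (1995), I.3.2.
-/

open scoped MatrixGroups Matrix ContDiff
open Polynomial

noncomputable section

namespace Literature.NumberTheory.Automorphic

/-! ### 1. A finite-dimensional space of functions is determined by a finite set of points -/

section Determining

variable {𝕜 X : Type*} [Field 𝕜]

/-- **A finite-dimensional space of functions is determined by its values on a finite set**: if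
`E` is a finite-dimensional subspace of the `𝕜`-valued functions on `X`, there is a finite
`T ⊆ X` such that `u ∈ E` and `u|_T = 0` force `u = 0`. Induction on `dim E`: if some `u₀ ∈ E`
does not vanish at `x₀`, the subspace `E' = {u ∈ E | u x₀ = 0}` is strictly smaller, and a
determining set for `E'` together with `x₀` determines `E`. [folklore] -/
theorem exists_finset_determining (E : Submodule 𝕜 (X → 𝕜)) [hE : FiniteDimensional 𝕜 E] :
    ∃ T : Finset X, ∀ u ∈ E, (∀ x ∈ T, u x = 0) → u = 0 := by
  classical
  suffices h : ∀ (m : ℕ) (E : Submodule 𝕜 (X → 𝕜)), FiniteDimensional 𝕜 E →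
      Module.finrank 𝕜 E ≤ m → ∃ T : Finset X, ∀ u ∈ E, (∀ x ∈ T, u x = 0) → u = 0 from
    h _ E hE le_rfl
  intro m
  induction m with
  | zero =>
    intro E hE hm
    refine ⟨∅, fun u hu _ => ?_⟩
    have hbot : E = ⊥ := Submodule.finrank_eq_zero.mp (Nat.le_zero.mp hm)
    rw [hbot, Submodule.mem_bot] at hu
    exact hu
  | succ m ih =>
    intro E hE hm
    by_cases h0 : ∀ u ∈ E, u = 0
    · exact ⟨∅, fun u hu _ => h0 u hu⟩
    push Not at h0
    obtain ⟨u₀, hu₀E, hu₀⟩ := h0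
    obtain ⟨x₀, hx₀⟩ : ∃ x₀, u₀ x₀ ≠ 0 := Function.ne_iff.mp hu₀
    set E' : Submodule 𝕜 (X → 𝕜) := E ⊓ LinearMap.ker (LinearMap.proj x₀ : (X → 𝕜) →ₗ[𝕜] 𝕜)
      with hE'
    have hE'le : E' ≤ E := inf_le_left
    haveI : FiniteDimensional 𝕜 E' := Submodule.finiteDimensional_of_le hE'le
    have hlt : E' < E := by
      refine lt_of_le_of_ne hE'le fun h => hx₀ ?_
      have hu₀E' : u₀ ∈ E' := h ▸ hu₀E
      exact LinearMap.mem_ker.mp (Submodule.mem_inf.mp hu₀E').2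
    have hm' : Module.finrank 𝕜 E' ≤ m :=
      Nat.lt_succ_iff.mp (lt_of_lt_of_le (Submodule.finrank_lt_finrank_of_lt hlt) hm)
    obtain ⟨T', hT'⟩ := ih E' inferInstance hm'
    refine ⟨insert x₀ T', fun u hu hT => ?_⟩
    have huE' : u ∈ E' :=
      Submodule.mem_inf.mpr ⟨hu, LinearMap.mem_ker.mpr (hT x₀ (Finset.mem_insert_self _ _))⟩
    exact hT' u huE' fun x hx => hT x (Finset.mem_insert_of_mem hx)

end Determining

/-! ### 2. Commuting one-parameter families: vanishing propagates from a finite grid -/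

section Grid

variable {G : Type*} [Group G]

/-- Peeling off the last factor of an ordered product over `Fin (d + 1)`:
`∏_{i ≤ d} eᵢ(tᵢ) = (∏_{i < d} eᵢ(tᵢ)) · e_d(t_d)` (`List.ofFn_succ'`). [folklore] -/
theorem prod_ofFn_flow_succ {d : ℕ} (e : Fin (d + 1) → ℝ → G) (t : Fin (d + 1) → ℝ) :
    (List.ofFn fun i => e i (t i)).prod =
      (List.ofFn fun i : Fin d => e (Fin.castSucc i) (t (Fin.castSucc i))).prod *
        e (Fin.last d) (t (Fin.last d)) := by
  rw [List.ofFn_succ', List.prod_concat]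

/-- An element commuting with every factor commutes with the ordered product. [folklore] -/
theorem commute_prod_ofFn_flow {d : ℕ} (e : Fin d → ℝ → G) (t : Fin d → ℝ) {x : G}
    (h : ∀ i, Commute x (e i (t i))) : Commute x (List.ofFn fun i => e i (t i)).prod := by
  refine Commute.list_prod_right _ _ fun y hy => ?_
  rw [List.mem_ofFn'] at hy
  obtain ⟨i, rfl⟩ := hy
  exact h i

/-- **Vanishing propagates from a finite grid along commuting flows.** Let `e₀, …, e_{d-1}` be
pairwise commuting one-parameter families in `G` (`eᵢ(s) eⱼ(t) = eⱼ(t) eᵢ(s)`), and `Eᵢ`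
subspaces of functions on `ℝ` determined by finite sets `Tᵢ` (`u ∈ Eᵢ`, `u|_{Tᵢ} = 0 ⟹ u = 0`).
If all slices of `φ` along the `eᵢ` lie in `Eᵢ` and `φ` vanishes at the grid points
`g · e₀(t₀) ⋯ e_{d-1}(t_{d-1})`, `tᵢ ∈ Tᵢ`, then `φ (g · e₀(s₀) ⋯ e_{d-1}(s_{d-1})) = 0` for all
`s ∈ ℝ^d`. Induction on `d`: for a grid point `t'` of the first `d - 1` flows the slice
`r ↦ φ (g · ∏ eᵢ(t'ᵢ) · e_{d-1}(r))` lies in `E_{d-1}` and vanishes on `T_{d-1}`, hence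
everywhere; commuting `e_{d-1}(r)` past the other flows, the induction hypothesis at the base
point `g · e_{d-1}(r)` finishes. [folklore] -/
theorem eq_zero_of_forall_grid :
    ∀ {d : ℕ} (e : Fin d → ℝ → G) (E : Fin d → Submodule ℂ (ℝ → ℂ)) (T : Fin d → Finset ℝ),
      (∀ i j s t, Commute (e i s) (e j t)) →
      (∀ i, ∀ u ∈ E i, (∀ s ∈ T i, u s = 0) → u = 0) →
      ∀ φ : G → ℂ, (∀ (i : Fin d) (g : G), (fun s => φ (g * e i s)) ∈ E i) → ∀ g : G,
        (∀ t : Fin d → ℝ, (∀ i, t i ∈ T i) → φ (g * (List.ofFn fun i => e i (t i)).prod) = 0) →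
        ∀ s : Fin d → ℝ, φ (g * (List.ofFn fun i => e i (s i)).prod) = 0 := by
  intro d
  induction d with
  | zero =>
    intro e E T _ _ φ _ g h0 s
    exact h0 s fun i => Fin.elim0 i
  | succ d ih =>
    intro e E T hcomm hT φ hφ g h0 s
    -- the first `d` flows
    set e' : Fin d → ℝ → G := fun i => e (Fin.castSucc i) with he'
    set E' : Fin d → Submodule ℂ (ℝ → ℂ) := fun i => E (Fin.castSucc i) with hE'
    set T' : Fin d → Finset ℝ := fun i => T (Fin.castSucc i) with hT'
    have hφ' : ∀ (i : Fin d) (g : G), (fun s => φ (g * e' i s)) ∈ E' i :=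
      fun i g => hφ (Fin.castSucc i) g
    -- step 1: vanishing on `g · ∏ e'(t') · e_d(r)` for grid points `t'` and all `r`
    have step1 : ∀ t' : Fin d → ℝ, (∀ i, t' i ∈ T' i) → ∀ r : ℝ,
        φ (g * (List.ofFn fun i => e' i (t' i)).prod * e (Fin.last d) r) = 0 := by
      intro t' ht'
      have hu : (fun r => φ (g * (List.ofFn fun i => e' i (t' i)).prod * e (Fin.last d) r)) ∈
          E (Fin.last d) :=
        hφ (Fin.last d) (g * (List.ofFn fun i => e' i (t' i)).prod)
      have hzero := hT (Fin.last d) _ hu (fun r hr => by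
        have h := h0 (Fin.snoc t' r) (fun i => by
          refine Fin.lastCases ?_ (fun j => ?_) i
          · rw [Fin.snoc_last]; exact hr
          · rw [Fin.snoc_castSucc]; exact ht' j)
        rw [prod_ofFn_flow_succ] at h
        simp only [Fin.snoc_castSucc, Fin.snoc_last] at h
        rw [← mul_assoc] at h
        exact h)
      intro r
      exact congrFun hzero r
    -- step 2: commute the last flow past the others and use the induction hypothesis
    set r : ℝ := s (Fin.last d) with hr
    set s' : Fin d → ℝ := fun i => s (Fin.castSucc i) with hs'
    have hc : ∀ t' : Fin d → ℝ, Commute (e (Fin.last d) r) (List.ofFn fun i => e' i (t' i)).prod :=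
      fun t' => commute_prod_ofFn_flow e' t' fun i => hcomm _ _ _ _
    have h0' : ∀ t' : Fin d → ℝ, (∀ i, t' i ∈ T' i) →
        φ (g * e (Fin.last d) r * (List.ofFn fun i => e' i (t' i)).prod) = 0 := by
      intro t' ht'
      rw [mul_assoc, (hc t').eq, ← mul_assoc]
      exact step1 t' ht' r
    have hih := ih e' E' T' (fun i j s t => hcomm _ _ _ _) (fun i => hT (Fin.castSucc i)) φ hφ'
      (g * e (Fin.last d) r) h0' s'
    rw [prod_ofFn_flow_succ, ← mul_assoc]
    change φ (g * (List.ofFn fun i => e' i (s' i)).prod * e (Fin.last d) r) = 0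
    rw [mul_assoc, ← (hc s').eq, ← mul_assoc]
    exact hih

end Grid

/-! ### 3. Central one-parameter subgroups of a linear real group -/

section Central

variable {A : Type*} [NormedCommRing A] [NormedAlgebra ℝ A] [NormedAlgebra ℚ A] [CompleteSpace A]
  [StarRing A] {N : Type*} [Fintype N] [DecidableEq N] {H : RealMatrixGroup A N}
  {G : Type*} [Group G] (ι : H.carrier →* G)

/-- `exp (X + Y) = exp X · exp Y` in `G` for commuting `X, Y ∈ 𝔤` (`Matrix.exp_add_of_commute`).
Knapp, 0.§2. [folklore] -/
theorem RealMatrixGroup.expMem_add_of_commute (X Y : H.lie)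
    (h : Commute (X : Matrix N N A) (Y : Matrix N N A)) :
    H.expMem (X + Y) = H.expMem X * H.expMem Y := by
  refine Subtype.ext (Units.ext ?_)
  change NormedSpace.exp ((X : Matrix N N A) + (Y : Matrix N N A)) =
    NormedSpace.exp (X : Matrix N N A) * NormedSpace.exp (Y : Matrix N N A)
  exact Matrix.exp_add_of_commute _ _ h

/-- `exp X` and `exp Y` commute in `G` for commuting `X, Y ∈ 𝔤`. Knapp, 0.§2. [folklore] -/
theorem RealMatrixGroup.commute_expMem_of_commute {X Y : H.lie}
    (h : Commute (X : Matrix N N A) (Y : Matrix N N A)) :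
    Commute (H.expMem X) (H.expMem Y) := by
  change H.expMem X * H.expMem Y = H.expMem Y * H.expMem X
  rw [← RealMatrixGroup.expMem_add_of_commute X Y h, ← RealMatrixGroup.expMem_add_of_commute Y X
    h.symm, add_comm]

/-- `exp 0 = 1` in `G`. Knapp, 0.§2. [folklore] -/
theorem RealMatrixGroup.expMem_zero_eq_one : H.expMem (0 : H.lie) = 1 := by
  refine Subtype.ext ?_
  change expGL (0 : Matrix N N A) = 1
  exact expGL_zero

/-- **The exponential of a sum of commuting elements is the ordered product of the
exponentials**: `ι(exp (∑ tᵢ Zᵢ)) = ι(exp (t₀ Z₀)) ⋯ ι(exp (t_{d-1} Z_{d-1}))` for pairwise commuting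
`Zᵢ ∈ 𝔤`. Knapp, 0.§2. [folklore] -/
theorem map_expMem_sum_smul_eq_prod_ofFn :
    ∀ {d : ℕ} (Z : Fin d → H.lie), (∀ i j, Commute (Z i : Matrix N N A) (Z j : Matrix N N A)) →
      ∀ t : Fin d → ℝ,
        ι (H.expMem (∑ i, t i • Z i)) = (List.ofFn fun i => ι (H.expMem (t i • Z i))).prod := by
  intro d
  induction d with
  | zero =>
    intro Z _ t
    rw [List.ofFn_zero, List.prod_nil, Finset.univ_eq_empty, Finset.sum_empty,
      RealMatrixGroup.expMem_zero_eq_one, map_one]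
  | succ d ih =>
    intro Z hZ t
    have hcomm : Commute ((∑ i : Fin d, t (Fin.castSucc i) • Z (Fin.castSucc i) : H.lie) :
        Matrix N N A) ((t (Fin.last d) • Z (Fin.last d) : H.lie) : Matrix N N A) := by
      rw [AddSubmonoidClass.coe_finsetSum]
      refine Commute.sum_left _ _ _ fun i _ => ?_
      change Commute (t (Fin.castSucc i) • (Z (Fin.castSucc i) : Matrix N N A))
        (t (Fin.last d) • (Z (Fin.last d) : Matrix N N A))
      exact ((hZ _ _).smul_left _).smul_right _
    rw [Fin.sum_univ_castSucc, prod_ofFn_flow_succ (fun i s => ι (H.expMem (s • Z i))) t,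
      RealMatrixGroup.expMem_add_of_commute _ _ hcomm, map_mul,
      ih (fun i => Z (Fin.castSucc i)) (fun i j => hZ _ _) (fun i => t (Fin.castSucc i))]

/-- Central elements of `𝔤` commute as matrices with every element of `𝔤`. [folklore] -/
theorem commute_coe_of_forall_lie_eq_zero {Z : H.lie} (hZ : ∀ Y : H.lie, ⁅Z, Y⁆ = 0) (Y : H.lie) :
    Commute (Z : Matrix N N A) (Y : Matrix N N A) := by
  have h := congrArg (fun W : H.lie => (W : Matrix N N A)) (hZ Y)
  simp only [LieSubalgebra.coe_bracket, ZeroMemClass.coe_zero] at h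
  rw [Ring.lie_def, sub_eq_zero] at h
  exact h

/-- **Functions annihilated by `J` are determined along commuting central one-parameter
subgroups by a finite grid.** Let `Z₀, …, Z_{d-1} ∈ 𝔤` be central and `J ≤ Z(𝔤)` an ideal of
finite codimension. There are a submodule `W` of the functions `G → ℂ` containing every
archimedean-smooth `φ` annihilated by `J` (every central word with image in `J` kills `φ`, the
hypothesis of `harishChandra_finiteness`), and finite sets `T₀, …, T_{d-1} ⊂ ℝ`, such that every
`φ ∈ W` vanishing at the points `g · ι(exp (∑ tᵢ Zᵢ))`, `tᵢ ∈ Tᵢ`, vanishes at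
`g · ι(exp (∑ sᵢ Zᵢ))` for every `s ∈ ℝ^d` (for every `g ∈ G`). Proof: the slices of such `φ`
along `exp (s Zᵢ)` lie in the finite-dimensional solution space `E_i` of the ODE attached to `Zᵢ`
and `J` (`exists_finrank_span_oneParam_le`), which is determined by a finite set
(`exists_finset_determining`); `W` is the submodule of functions with slices in the `Eᵢ`, the
subgroups `exp (s Zᵢ)` commute, `exp (∑ tᵢ Zᵢ) = ∏ exp (tᵢ Zᵢ)` (`map_expMem_sum_smul_eq_prod_ofFn`),
and `eq_zero_of_forall_grid` applies. This is the device by which the split centre (and, for a torus, the whole archimedean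
group) is disposed of in Harish-Chandra's finiteness theorem (Borel 1997, 8.6;
Moeglin–Waldspurger I.3.2). [cite: Borel1997, 8.6] -/
theorem exists_submodule_forall_central_grid (J : Ideal (centerU H))
    [FiniteDimensional ℝ (centerU H ⧸ J)] {d : ℕ} (Z : Fin d → H.lie)
    (hZ : ∀ (i : Fin d) (Y : H.lie), ⁅Z i, Y⁆ = 0) :
    ∃ (W : Submodule ℂ (G → ℂ)) (T : Fin d → Finset ℝ),
      (∀ φ : G → ℂ, IsArchSmooth ι φ →
        (∀ (p : FreeAlgebra ℝ H.lie) (hp : IsCentralWord p),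
          (⟨freeToEnveloping H p, hp⟩ : centerU H) ∈ J → applyFree ι p φ = 0) → φ ∈ W) ∧
      ∀ φ ∈ W, ∀ g : G,
        (∀ t : Fin d → ℝ, (∀ i, t i ∈ T i) → φ (g * ι (H.expMem (∑ i, t i • Z i))) = 0) →
        ∀ s : Fin d → ℝ, φ (g * ι (H.expMem (∑ i, s i • Z i))) = 0 := by
  classical
  -- the solution spaces along the `Zᵢ`
  have h := fun i => exists_finrank_span_oneParam_le ι J (hZ i)
  choose q hq0 hfin hrank hmem using h
  set E : Fin d → Submodule ℂ (ℝ → ℂ) := fun i => Submodule.span ℂ {u : ℝ → ℂ | ContDiff ℝ ∞ u ∧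
    ∀ t, ∑ k ∈ Finset.range ((q i).natDegree + 1), (q i).coeff k * iteratedDeriv k u t = 0} with hE
  have hT := fun i => @exists_finset_determining ℂ ℝ _ (E i) (hfin i)
  choose T hT using hT
  set e : Fin d → ℝ → G := fun i s => ι (H.expMem (s • Z i)) with he
  have hZc : ∀ i j, Commute (Z i : Matrix N N A) (Z j : Matrix N N A) := fun i j =>
    commute_coe_of_forall_lie_eq_zero (hZ i) (Z j)
  have hcomm : ∀ i j s t, Commute (e i s) (e j t) := by
    intro i j s t
    have hc : Commute (H.expMem (s • Z i)) (H.expMem (t • Z j)) := by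
      refine RealMatrixGroup.commute_expMem_of_commute ?_
      change Commute (s • (Z i : Matrix N N A)) (t • (Z j : Matrix N N A))
      exact ((hZc i j).smul_left s).smul_right t
    exact hc.map ι
  -- the submodule of functions whose slices along the `exp (s Zᵢ)` lie in the `Eᵢ`
  let W : Submodule ℂ (G → ℂ) :=
    { carrier := {φ | ∀ (i : Fin d) (g : G), (fun s => φ (g * e i s)) ∈ E i}
      zero_mem' := fun i _ => (E i).zero_mem
      add_mem' := fun {φ ψ} hφ hψ i g => by
        have h := (E i).add_mem (hφ i g) (hψ i g)
        exact h
      smul_mem' := fun c φ hφ i g => by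
        have h := (E i).smul_mem c (hφ i g)
        exact h }
  refine ⟨W, T, fun φ hφs hφ => ?_, fun φ hφ g h0 s => ?_⟩
  · intro i g
    exact Submodule.subset_span (hmem i φ hφs hφ g)
  · rw [map_expMem_sum_smul_eq_prod_ofFn ι Z hZc s]
    refine eq_zero_of_forall_grid e E T hcomm hT φ hφ g (fun t ht => ?_) s
    rw [← map_expMem_sum_smul_eq_prod_ofFn ι Z hZc t]
    exact h0 t ht

end Central

/-! ### 4. Interpolation with coefficients on a finite-dimensional space of functions -/

section Interpolation

variable {𝕜 X : Type*} [Field 𝕜]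

/-- **Interpolation on a finite-dimensional space of functions**: if `E` is a finite-dimensional
subspace of the `𝕜`-valued functions on `X`, there are a finite `T ⊆ X` and functions `b_x ∈ E`
such that every `u ∈ E` is recovered from its values on `T`: `u = ∑_{x ∈ T} u(x) · b_x`. (Take a
determining set `T`, `exists_finset_determining`; restriction to `T` is then an injective linear
map `E → 𝕜^T`, and a linear left inverse applied to the coordinate vectors gives the `b_x`.)
[folklore] -/
theorem exists_finset_interpolation (E : Submodule 𝕜 (X → 𝕜)) [hE : FiniteDimensional 𝕜 E] :
    ∃ (T : Finset X) (b : X → X → 𝕜), (∀ x, b x ∈ E) ∧ ∀ u ∈ E, u = ∑ x ∈ T, u x • b x := by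
  classical
  obtain ⟨T, hT⟩ := exists_finset_determining E
  -- restriction to `T`, injective on `E`
  let r : E →ₗ[𝕜] (T → 𝕜) := (LinearMap.funLeft 𝕜 𝕜 (Subtype.val : T → X)).comp E.subtype
  have hr : LinearMap.ker r = ⊥ := by
    refine LinearMap.ker_eq_bot'.2 fun u hu => Subtype.ext (hT u u.2 fun x hx => ?_)
    exact congrFun hu ⟨x, hx⟩
  obtain ⟨L, hL⟩ := r.exists_leftInverse_of_injective hr
  refine ⟨T, fun x => if hx : x ∈ T then ((L (Pi.single (M := fun _ => 𝕜) ⟨x, hx⟩ 1) : E) : X → 𝕜)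
    else 0, fun x => ?_, fun u hu => ?_⟩
  · dsimp only
    by_cases hx : x ∈ T
    · rw [dif_pos hx]; exact (L _).2
    · rw [dif_neg hx]; exact E.zero_mem
  · have h1 : (⟨u, hu⟩ : E) = L (r ⟨u, hu⟩) := by
      have h := LinearMap.congr_fun hL ⟨u, hu⟩
      rw [LinearMap.comp_apply, LinearMap.id_apply] at h
      exact h.symm
    have h2 : r ⟨u, hu⟩ = ∑ t : T, u t • Pi.single (M := fun _ => 𝕜) t 1 :=
      pi_eq_sum_univ' (r ⟨u, hu⟩)
    have h3 : u = ((L (r ⟨u, hu⟩) : E) : X → 𝕜) := congrArg Subtype.val h1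
    conv_lhs => rw [h3, h2, map_sum, Submodule.coe_sum]
    rw [← Finset.sum_coe_sort T]
    refine Finset.sum_congr rfl fun t _ => ?_
    dsimp only
    rw [map_smul, Submodule.coe_smul, dif_pos t.2]

end Interpolation

/-! ### 5. Functions of two variables with slices in finite-dimensional spaces -/

section Slices

variable {𝕜 X Y : Type*} [Field 𝕜]

/-- **Functions of two variables whose slices lie in finite-dimensional spaces span a
finite-dimensional space** (the linear algebra of the Levi step of Harish-Chandra's finiteness
theorem: a function on a product `M₁ × M₂` automorphic of bounded type in each variable separately
lies in `𝒜₁ ⊗ 𝒜₂`). If `W₁` (functions on `X`) and `W₂` (functions on `Y`) are finite-dimensional,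
there is ONE finite-dimensional space `V` of functions on `X × Y` containing every `f` with
`f(·, y) ∈ W₁` for all `y` and `f(x, ·) ∈ W₂` for all `x`: by interpolation on `W₁`
(`exists_finset_interpolation`), `f(x, y) = ∑_{s ∈ T} f(s, y) b_s(x)`, and each `f(s, ·)` lies in
`W₂`, so `f ∈ ∑_{s ∈ T} b_s ⊗ W₂`. [folklore] -/
theorem exists_finiteDimensional_forall_slices_mem (W₁ : Submodule 𝕜 (X → 𝕜))
    (W₂ : Submodule 𝕜 (Y → 𝕜)) [FiniteDimensional 𝕜 W₁] [FiniteDimensional 𝕜 W₂] :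
    ∃ V : Submodule 𝕜 (X × Y → 𝕜), FiniteDimensional 𝕜 V ∧
      ∀ f : X × Y → 𝕜, (∀ y, (fun x => f (x, y)) ∈ W₁) → (∀ x, (fun y => f (x, y)) ∈ W₂) →
        f ∈ V := by
  classical
  obtain ⟨T, b, -, hrepr⟩ := exists_finset_interpolation W₁
  -- `w ↦ ((x, y) ↦ b_s(x) w(y))`
  let L : X → (Y → 𝕜) →ₗ[𝕜] (X × Y → 𝕜) := fun s =>
    { toFun := fun w p => b s p.1 * w p.2
      map_add' := fun w w' => by
        ext p
        simp only [Pi.add_apply, mul_add]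
      map_smul' := fun c w => by
        ext p
        simp only [Pi.smul_apply, smul_eq_mul, RingHom.id_apply, mul_left_comm] }
  refine ⟨T.sup fun s => W₂.map (L s), inferInstance, fun f h1 h2 => ?_⟩
  have hf : f = ∑ s ∈ T, L s (fun y => f (s, y)) := by
    ext ⟨x, y⟩
    have h := congrFun (hrepr _ (h1 y)) x
    simp only [Finset.sum_apply, Pi.smul_apply, smul_eq_mul] at h
    rw [h, Finset.sum_apply]
    refine Finset.sum_congr rfl fun s _ => ?_
    change f (s, y) * b s x = b s x * f (s, y)
    rw [mul_comm]
  rw [hf]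
  refine Submodule.sum_mem _ fun s hs => ?_
  have hle : W₂.map (L s) ≤ T.sup fun s => W₂.map (L s) := Finset.le_sup (f := fun s => W₂.map (L s)) hs
  exact hle (Submodule.mem_map_of_mem (h2 s))

end Slices

/-! ### 6. Translates along a central one-parameter subgroup -/

section CentralTranslates

variable {A : Type*} [NormedCommRing A] [NormedAlgebra ℝ A] [NormedAlgebra ℚ A] [CompleteSpace A]
  [StarRing A] {N : Type*} [Fintype N] [DecidableEq N] {H : RealMatrixGroup A N}
  {G : Type*} [Group G] (ι : H.carrier →* G)

/-- **Interpolation along a central one-parameter subgroup.** For `Z ∈ 𝔤` central and `J ≤ Z(𝔤)`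
of finite codimension there are finitely many parameters `T ⊂ ℝ` and coefficient functions
`b_t : ℝ → ℂ` such that for every archimedean-smooth `φ : G → ℂ` annihilated by `J`, every `g ∈ G`
and every `s ∈ ℝ`, `φ (g · ι(exp sZ)) = ∑_{t ∈ T} φ (g · ι(exp tZ)) · b_t(s)`: the slices lie in
one finite-dimensional space of functions of `s` (`exists_finrank_span_oneParam_le`), on which
interpolation holds (`exists_finset_interpolation`). Borel 1997, 8.6; Moeglin–Waldspurger I.3.2
(`φ(ag) = ∑ φᵢ(g) eᵢ(a)`). [cite: Borel1997, 8.6] -/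
theorem exists_finset_interpolation_central (J : Ideal (centerU H))
    [FiniteDimensional ℝ (centerU H ⧸ J)] {Z : H.lie} (hZ : ∀ Y : H.lie, ⁅Z, Y⁆ = 0) :
    ∃ (T : Finset ℝ) (b : ℝ → ℝ → ℂ), ∀ φ : G → ℂ, IsArchSmooth ι φ →
      (∀ (p : FreeAlgebra ℝ H.lie) (hp : IsCentralWord p),
        (⟨freeToEnveloping H p, hp⟩ : centerU H) ∈ J → applyFree ι p φ = 0) →
      ∀ (g : G) (s : ℝ), φ (g * ι (H.expMem (s • Z))) =
        ∑ t ∈ T, φ (g * ι (H.expMem (t • Z))) * b t s := by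
  obtain ⟨q, -, hfin, -, hmem⟩ := exists_finrank_span_oneParam_le ι J hZ
  obtain ⟨T, b, -, hrepr⟩ := @exists_finset_interpolation ℂ ℝ _ _ hfin
  refine ⟨T, b, fun φ hφs hφ g s => ?_⟩
  have h := congrFun (hrepr _ (Submodule.subset_span (hmem φ hφs hφ g))) s
  simpa only [Finset.sum_apply, Pi.smul_apply, smul_eq_mul] using h

/-- **The translates of `φ` along a central one-parameter subgroup span a finite-dimensional
space** (of dimension at most `|T|`, uniformly in `φ`): with `T` as in
`exists_finset_interpolation_central`, every right translate `g ↦ φ (g · ι(exp sZ))` of an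
archimedean-smooth `φ` annihilated by `J` is a linear combination of the finitely many translates
with `s ∈ T`; in particular the span of all these translates is finite-dimensional (for `GL_n`
and `Z = 1` this is the `A_G`-finiteness of automorphic forms). Borel 1997, 8.6;
Borel–Jacquet 1979, 4.3. [cite: Borel1997, 8.6] -/
theorem exists_finset_translate_expMem_mem_span (J : Ideal (centerU H))
    [FiniteDimensional ℝ (centerU H ⧸ J)] {Z : H.lie} (hZ : ∀ Y : H.lie, ⁅Z, Y⁆ = 0) :
    ∃ T : Finset ℝ, ∀ φ : G → ℂ, IsArchSmooth ι φ →
      (∀ (p : FreeAlgebra ℝ H.lie) (hp : IsCentralWord p),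
        (⟨freeToEnveloping H p, hp⟩ : centerU H) ∈ J → applyFree ι p φ = 0) →
      (∀ s : ℝ, (fun g => φ (g * ι (H.expMem (s • Z)))) ∈
          Submodule.span ℂ ((fun t : ℝ => fun g => φ (g * ι (H.expMem (t • Z)))) '' ↑T)) ∧
        FiniteDimensional ℂ (Submodule.span ℂ
          (Set.range fun s : ℝ => fun g => φ (g * ι (H.expMem (s • Z))))) := by
  obtain ⟨T, b, hT⟩ := exists_finset_interpolation_central ι J hZ
  refine ⟨T, fun φ hφs hφ => ?_⟩
  have hmem : ∀ s : ℝ, (fun g => φ (g * ι (H.expMem (s • Z)))) ∈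
      Submodule.span ℂ ((fun t : ℝ => fun g => φ (g * ι (H.expMem (t • Z)))) '' ↑T) := by
    intro s
    have hs : (fun g => φ (g * ι (H.expMem (s • Z)))) =
        ∑ t ∈ T, b t s • fun g => φ (g * ι (H.expMem (t • Z))) := by
      funext g
      rw [hT φ hφs hφ g s, Finset.sum_apply]
      refine Finset.sum_congr rfl fun t _ => ?_
      rw [Pi.smul_apply, smul_eq_mul, mul_comm]
    rw [hs]
    refine Submodule.sum_mem _ fun t ht => Submodule.smul_mem _ _ (Submodule.subset_span ?_)
    exact ⟨t, ht, rfl⟩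
  refine ⟨hmem, ?_⟩
  have hle : Submodule.span ℂ (Set.range fun s : ℝ => fun g => φ (g * ι (H.expMem (s • Z)))) ≤
      Submodule.span ℂ ((fun t : ℝ => fun g => φ (g * ι (H.expMem (t • Z)))) '' ↑T) := by
    refine Submodule.span_le.2 ?_
    rintro _ ⟨s, rfl⟩
    exact hmem s
  haveI : FiniteDimensional ℂ (Submodule.span ℂ
      ((fun t : ℝ => fun g => φ (g * ι (H.expMem (t • Z)))) '' (↑T : Set ℝ))) :=
    FiniteDimensional.span_of_finite ℂ ((T.finite_toSet).image _)
  exact Submodule.finiteDimensional_of_le hle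

end CentralTranslates

end Literature.NumberTheory.Automorphic
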